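import Literature.NumberTheory.EllipticCurves.Kato2004.EulerSystemClassNonvanishingProofs
import Literature.NumberTheory.EllipticCurves.Kato2004.AdmissibleZetaClassNonvanishingProofs
import Literature.NumberTheory.EllipticCurves.Kato2004.IwasawaH1RankLowerBoundProofs
import HarnessLib

/-!
# Kato 2004 (Astérisque 295): hypothesis (i) of Thm. 13.4 / the lower bound `𝐇¹_Γ(T_pW) ≠ 0` IN EVERY
# ANALYTIC RANK — a NON-ZERO genuine Λ-adic Euler-system class exists in `𝐇¹_Γ(T_pW)` (odd `p`, `W[p]`
# irreducible), granted only Kato's construction fact `exists_eulerSystem_expStar_values` and ROHRLICH's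
# non-vanishing theorem for the newform of `W` at `p` (THEOREMS ONLY; the all-layers twin of
# `EulerSystemClassNonvanishingProofs`)

Topic `NumberTheory/EllipticCurves`, sub-directory `Kato2004` (namespace = path). THEOREMS ONLY (net debt 0): no
`def`, no named fact, no instance, no notation, no `sorry`. Prover seat `bsd-line-dkd-w2` (g1; stub worker of the
print stub F2 `stub_oneLeRankIwasawaH1` = `Kato2004.one_le_rank_iwasawaH1` of line `descent` on crux
stmt-BirchSwinnertonDyer-23259 `FineLengthLeOneOfAnalyticRankTwo`, route `DerivedKatoValuationDoor`). HONEST FRAMING: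
BSD is not proved by any of this; nothing about Kato's Main Conjecture is asserted; every theorem of §2 is
CONDITIONAL on the construction fact `exists_eulerSystem_expStar_values` (def:Prop, no `_holds`) and takes a newform of
`W` (modularity) and Rohrlich's theorem as displayed hypotheses — the latter in the exact shape discharged by the
tree's `Rohrlich1984_nonvanishing_twists.primePow_of_isNewformOf` (`p ∤ N`) and by the Summits-side
`PSRohrlichAtLevel.rohrlich_primePow_of_isNewformOf` (every `p`).

## Why (the binder it discharges)

`EulerSystemClassNonvanishingProofs.exists_isEulerSystemClass_ne_zero` produced a non-zero genuine class only when
`L(W,1) ≠ 0`: it reads the BOTTOM layer `z_{0,∅}`, whose value is `κ·L_{(pA)}(f,1)/Ω⁺_f·R⁻`. On rows of analytic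
rank `≥ 1` (the regime of the route `DerivedKatoValuationDoor`, `a = 2`) the bottom value vanishes and Kato's
argument for Thm. 12.5 (1) [pp. 221–222] reads a HIGHER layer through a non-trivial character of `Gal(ℚ_n/ℚ)`:
«by a theorem of Rohrlich [Ro1], `L(f, χ, r) ≠ 0` for almost all characters `χ` of `Gal(ℚ(ζ_{p^∞})/ℚ)` … hence
`z_γ ≠ 0`». The tree already proved that mechanism for ADMISSIBLE classes
(`IsAdmissibleZetaClass.ne_zero_of_rohrlich`, which first unpacks the position clause (A6′) to reach the Λ-adic
lift `y` of the witnessing family); this file runs it DIRECTLY on the Λ-adic lift `y` of any guarded `ZetaBody`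
family, so that no admissible class (whose existence needs (12.5.2)-integrality, Kato 13.12–13.14) is required:

* §1 `zetaBody_lift_ne_zero_of_rohrlich` — for a `ZetaBody W p f ι κ Λ c d a A z x` witness with `κ ≠ 0`, `f` the
  newform of `W`, guards `(c, 6pA) = (d, 6pN) = 1`, `dd′ ≡ 1 (A)`, `A ≥ 1` and VALUE GUARD `R⁻_𝟙(c,d,a,A,d′) ≠ 0`,
  `p` odd, `K` cyclotomic, and `y ∈ 𝐇¹_Γ(T_pW)` with `proj_n y = Cor_{ℚ(μ_{p^{n+1}})/ℚ_n}(z_{n+1,∅})` for all `n`: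
  Rohrlich's finiteness for `f` at `p` gives `y ≠ 0`. Mechanism: `y = 0` kills every layer
  (`ZetaBodyLayerValuesProofs.zetaBody_depletedL_mul_cuspFactor_eq_zero_of_levelToLayer_eq_zero`: then
  `Lχ(1)·R⁻_χ̄ = 0` for every even character `χ` of `Gal(ℚ_n/ℚ)` mod `p^{n+1}`); a LAYER character with
  `R⁻_χ̄ ≠ 0` exists at every large level (`LayerCharacter.exists_layerCharacter_cuspFactor_ne_zero`, from
  `R⁻_𝟙 ≠ 0`); off Rohrlich's finite exceptional set the entire continuation of `L(f,χ,s)` has `L(1) ≠ 0`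
  (Shimura `exists_differentiable_eq_twistedLSeries_holds`), and so does the depleted one
  (`exists_continuation_changeLevel_of`) — contradiction.
* §2 `exists_isEulerSystemClass_ne_zero_of_rohrlich` — for every elliptic `W/ℚ` with `W[p]` irreducible (`p`
  odd), newform `f`, cyclotomic `κ` and EVERY pinned `I : IwasawaH1Data W p κ γ`: GRANTED
  `exists_eulerSystem_expStar_values` and Rohrlich for `f` at `p`, some `s ∈ 𝐇¹_Γ(T_pW)` has
  `IsEulerSystemClass W p κ γ I s ∧ s ≠ 0` — ANY analytic rank (guarded admissible data by
  `valueGuard_satisfiable`, lift by `exists_isEulerSystemClass_of_zetaBody`, §1). Corollaries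
  `nontrivial_iwasawaH1_of_expStar_values_of_rohrlich` (`𝐇¹_Γ(T_pW) ≠ 0`) and
  `one_le_rank_iwasawaH1_of_expStar_values_of_rohrlich` (`1 ≤ rank_Λ 𝐇¹_Γ(T_pW)`, with a topological generator:
  `𝐇¹` is torsion free, `IwasawaH1Data.isTorsionFree`) — the statement of the named fact
  `Kato2004.one_le_rank_iwasawaH1` ((12.2.2)) at odd irreducible primes of modular `W`, modulo the ONE
  construction fact; and `…_of_forall_not_dvd_level` with Rohrlich DISCHARGED in `Literature` when every newform
  of `W` has level prime to `p` (good reduction at `p`).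

## Source

K. Kato, Astérisque 295 (2004) [Kato2004Asterisque]: Thm. 12.5 (1) and its proof from Thm. 12.4 [pp. 221–222],
§13.8 [p. 228], Ex. 13.3 [p. 225], 13.9 [p. 229], Thm. 13.4 (i) [p. 226], Thm. 9.7 [p. 189], Thm. 6.6 (1) [p. 163];
D. E. Rohrlich, Invent. Math. 75 (1984), Theorem p. 409 [RohrlichInventiones1984] (entering as the hypothesis `hR`);
G. Shimura (entire continuation of twisted `L`-series; tree `exists_differentiable_eq_twistedLSeries_holds`);
L. C. Washington, *Introduction to Cyclotomic Fields* §13.1 [Washington1997]. Nothing beyond these readings (all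
already of record in the three imported files) is used.
-/

set_option autoImplicit false

noncomputable section

open scoped NumberField TensorProduct MatrixGroups
open Field IsDedekindDomain CongruenceSubgroup
open Literature.NumberTheory.GaloisRepresentations
open Literature.NumberTheory.EllipticCurves Literature.NumberTheory.EllipticCurves.ModularForms
open Literature.NumberTheory.EllipticCurves.Kato2004.EulerSystemValues Rat.HeightOneSpectrum

namespace Literature.NumberTheory.EllipticCurves.Kato2004

/-! ## §1 The Λ-adic lift of a guarded `ZetaBody` family is non-zero, given Rohrlich -/

section Lift

variable {W : WeierstrassCurve ℚ} [W.IsElliptic] {p : ℕ} [hp : Fact p.Prime]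
  [ContinuousSMul ℤ_[p] (W.tateModule p)] [Module.Free ℤ_[p] (W.tateModule p)]
  [Module.Finite ℤ_[p] (W.tateModule p)] {N : ℕ} [NeZero N] {f : CuspForm (Gamma0 N) 2}
  {ι : (m : ℕ) → (CyclotomicField m ℚ →+* ℂ)} {κ' : ℝ}
  {Λ' : ∀ (k : ℕ) (r : Finset (HeightOneSpectrum (𝓞 ℚ))),
    H1 (tateRep W p) (cycSubgroup p k r) →ₗ[ℤ_[p]] ℚ_[p] ⊗[ℚ] CyclotomicField (cycLevel p k r) ℚ}
  {c d a : ℤ} {A : ℕ}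
  {z : ∀ (k : ℕ) (r : (cyclotomicLevelsRat p (badPlaces c d A N)).Ideals),
    H1 (tateRep W p) ((cyclotomicLevelsRat p (badPlaces c d A N)).level k r.1)}
  {x : ∀ (k : ℕ) (r : (cyclotomicLevelsRat p (badPlaces c d A N)).Ideals),
    CyclotomicField (cycLevel p k r.1) ℚ}
  {K : ZpExtension ℚ p} {γ : absoluteGaloisGroup ℚ} {I : IwasawaH1Data W p K γ}

/-- **The Λ-adic lift of a guarded `ZetaBody` family is NON-ZERO, given Rohrlich's theorem for `f` at `p`** — in
EVERY analytic rank. Data: a `ZetaBody W p f ι κ Λ c d a A z x` witness with `κ ≠ 0` for `f` the newform of `W`,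
Kato's guards `A ≥ 1`, `(c, 6pA) = 1`, `(d, 6pN) = 1`, `dd′ ≡ 1 (A)` and the value guard
`R⁻_𝟙 = cuspFactor f true 1 c d a A d′ ≠ 0`; `p` odd, `K` a cyclotomic `ℤ_p`-extension, and `y ∈ 𝐇¹_Γ(T_pW)` with
layer components `proj_n y = Cor_{ℚ(μ_{p^{n+1}})/ℚ_n}(z_{n+1,∅})`. If only finitely many primitive characters of
`p`-power conductor have an entire continuation of `L(f,χ,s)` vanishing at `1` (Rohrlich, hypothesis `hR`), then
`y ≠ 0`: otherwise every layer vanishes, so `Lχ(1)·R⁻_χ̄ = 0` for every even character `χ` of `Gal(ℚ_n/ℚ)`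
(`zetaBody_depletedL_mul_cuspFactor_eq_zero_of_levelToLayer_eq_zero`), contradicting a layer character of large
conductor `p^{n+1}` with `R⁻_χ̄ ≠ 0` (`LayerCharacter.exists_layerCharacter_cuspFactor_ne_zero`) off Rohrlich's
exceptional set (`exists_differentiable_eq_twistedLSeries_holds`, `exists_continuation_changeLevel_of`). Kato's
step «`L(f,χ,1) ≠ 0` for almost all `χ` [Ro1] ⇒ `z_γ ≠ 0`» of the proof of Thm. 12.5 (1), run on the lift itself
(no admissible class, no (12.5.2)). [cite: Kato2004Asterisque, Thm. 12.5 (1) and proof (pp. 221–222), §13.8 (p. 228)] -/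
theorem zetaBody_lift_ne_zero_of_rohrlich (hbody : ZetaBody W p f ι κ' Λ' c d a A z x) (hf : IsNewformOf W f)
    (hκ' : κ' ≠ 0) (hA : 0 < A) (hc : Int.gcd c (6 * p * A) = 1) (hd : Int.gcd d (6 * p * N) = 1) {d' : ℤ}
    (hdd' : d * d' ≡ 1 [ZMOD (A : ℤ)]) (hRne : cuspFactor f true (fun _ ↦ (1 : ℂ)) c d a A d' ≠ 0)
    (hK : K.IsCyclotomic) (hp2 : p ≠ 2) {y : I.H}
    (hy : ∀ n : ℕ, I.proj n y = levelToLayer W p hK hp2 (badPlaces c d A N) n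
      (z (n + 1) (cyclotomicLevelsRat p (badPlaces c d A N)).idealOne))
    (hR : Set.Finite {χ : Σ m : ℕ, DirichletCharacter ℂ m |
        χ.1 ≠ 0 ∧ χ.1.primeFactors ⊆ {p} ∧ χ.2.IsPrimitive ∧
          ∃ L : ℂ → ℂ, Differentiable ℂ L ∧
            (∀ s : ℂ, 2 < s.re → L s = twistedLSeries f χ.2 s) ∧ L 1 = 0}) :
    y ≠ 0 := by
  intro hy0
  -- the rational value guard `R⁻_𝟙 ≠ 0`
  have hRne' : ratCuspFactor f true c d a A d' ≠ 0 := by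
    intro h0
    apply hRne
    rw [cuspFactor_one_eq_ratCuspFactor, h0, Rat.cast_zero]
  -- part 2a: a level `n₀` beyond which every `p^{n+1}` carries a layer character with `R⁻_χ̄ ≠ 0`
  obtain ⟨n₀, hn₀⟩ := LayerCharacter.exists_layerCharacter_cuspFactor_ne_zero f hp2
    (natAbs_coprime_of_gcd_six_mul_eq_one hc) (natAbs_coprime_of_gcd_six_mul_eq_one hd) a A d' hRne'
  -- Rohrlich: the exceptional levels are bounded by some `B`
  obtain ⟨B, hB⟩ := (hR.image Sigma.fst).bddAbove
  -- the level `M = p^{n+1}`, `n = n₀ + B + 1`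
  have hn₀n : n₀ ≤ n₀ + B + 1 := by omega
  have h1n : 1 ≤ n₀ + B + 1 := by omega
  have hBn : B < p ^ (n₀ + B + 1 + 1) :=
    lt_of_lt_of_le (by omega) (Nat.lt_pow_self hp.out.one_lt).le
  have hM : cycLevel p (n₀ + B + 1 + 1) ∅ = p ^ (n₀ + B + 1 + 1) := by simp [cycLevel]
  obtain ⟨χ, hker, hcusp⟩ := hn₀ (n₀ + B + 1) hn₀n (M := cycLevel p (n₀ + B + 1 + 1) ∅) hM
  have heven : χ (-1) = 1 := LayerCharacter.apply_neg_one hp2 hker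
  have hprim : χ.IsPrimitive := LayerCharacter.isPrimitive h1n hM hker
  have hlayer : ∀ σ ∈ K.layerSubgroup (n₀ + B + 1),
      χ ((modNCyclotomicCharacter ℚ (cycLevel p (n₀ + B + 1 + 1) ∅) σ :
          (ZMod (cycLevel p (n₀ + B + 1 + 1) ∅))ˣ) : ZMod (cycLevel p (n₀ + B + 1 + 1) ∅)) = 1 :=
    fun σ hσ => hK.dirichletCharacter_apply_eq_one_of_mem_layerSubgroup hp2 (n₀ + B + 1) hM χ
      (fun b hb => (hker b).mpr hb) hσ
  -- Shimura: an entire continuation `L₀` of `L(f, χ, s)`; Rohrlich off the exceptional levels: `L₀ 1 ≠ 0`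
  obtain ⟨L₀, hL₀d, hL₀s⟩ :=
    exists_differentiable_eq_twistedLSeries_holds f (m := cycLevel p (n₀ + B + 1 + 1) ∅) χ
  have hL₀1 : L₀ 1 ≠ 0 := by
    intro h0
    have hle : cycLevel p (n₀ + B + 1 + 1) ∅ ≤ B := by
      refine hB ⟨⟨cycLevel p (n₀ + B + 1 + 1) ∅, χ⟩, ?_, rfl⟩
      refine ⟨NeZero.ne _, ?_, hprim, L₀, hL₀d, hL₀s, h0⟩
      change (cycLevel p (n₀ + B + 1 + 1) ∅).primeFactors ⊆ {p}
      rw [hM, Nat.primeFactors_prime_pow (Nat.succ_ne_zero _) hp.out]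
    rw [hM] at hle
    exact absurd hle (not_le.mpr hBn)
  -- the depleted continuation at level `p^{n+1}·(pA)` does not vanish at `1` (Euler factors of `W` at `s = 1`)
  haveI : NeZero (cycLevel p (n₀ + B + 1 + 1) ∅ * (p * A)) :=
    ⟨mul_ne_zero (NeZero.ne _) (mul_ne_zero hp.out.ne_zero hA.ne')⟩
  obtain ⟨L, hLd, hLs, hL1⟩ := exists_continuation_changeLevel_of hf
    (dvd_mul_right (cycLevel p (n₀ + B + 1 + 1) ∅) (p * A)) χ ⟨L₀, hL₀d, hL₀s, hL₀1⟩
  have hdep : IsDepletedTwistedL f (cycLevel p (n₀ + B + 1 + 1) ∅) (p * A) χ L := ⟨hLd, hLs⟩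
  -- but every layer of `y = 0` vanishes, so the value law gives `L(1) · R⁻_χ̄ = 0`
  have h0 : levelToLayer W p hK hp2 (badPlaces c d A N) (n₀ + B + 1)
      (z (n₀ + B + 1 + 1) (cyclotomicLevelsRat p (badPlaces c d A N)).idealOne) = 0 := by
    rw [← hy (n₀ + B + 1), hy0, map_zero]
  exact mul_ne_zero hL1 hcusp
    (zetaBody_depletedL_mul_cuspFactor_eq_zero_of_levelToLayer_eq_zero hbody hf hκ' hK hp2 (n₀ + B + 1) h0 χ
      hlayer heven d' (gcd_mul_cycLevel_mul_eq_one_of_guards hc hd hdd' (n₀ + B + 1)) hdd' hdep)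

end Lift

/-! ## §2 Assembly: a non-zero genuine Euler-system class / `𝐇¹_Γ(T_pW) ≠ 0` in every analytic rank, modulo the
construction fact and Rohrlich -/

section Assembly

variable (W : WeierstrassCurve ℚ) [W.IsElliptic] (p : ℕ) [Fact p.Prime]
  [ContinuousSMul ℤ_[p] (W.tateModule p)] [Module.Free ℤ_[p] (W.tateModule p)]
  [Module.Finite ℤ_[p] (W.tateModule p)] {κ : ZpExtension ℚ p}
  {γ : absoluteGaloisGroup ℚ} (I : IwasawaH1Data W p κ γ)

/-- **Hypothesis (i) of Kato Thm. 13.4, DISCHARGED for odd `p` in EVERY analytic rank, modulo the construction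
fact and Rohrlich.** For every elliptic `W/ℚ` with `W[p]` irreducible (`p` odd), every newform `f` of `W`, every
cyclotomic `κ` and every pinned `I : IwasawaH1Data W p κ γ`: GRANTED `exists_eulerSystem_expStar_values` (Kato
(8.1.3)/Ex. 13.3 with Thm. 9.7 and Thm. 6.6 (1)) and Rohrlich's finiteness for `f` at `p` (hypothesis `hR`, the
shape of `Rohrlich1984_nonvanishing_twists.primePow_of_isNewformOf`), there is `s ∈ 𝐇¹_Γ(T_pW)` with
`IsEulerSystemClass W p κ γ I s` and `s ≠ 0`: a guarded admissible datum exists (`valueGuard_satisfiable`), its zeta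
family lifts to a genuine Euler-system class (`exists_isEulerSystemClass_of_zetaBody`) and the lift is non-zero
(`zetaBody_lift_ne_zero_of_rohrlich`). The `L(W,1) ≠ 0` hypothesis of `exists_isEulerSystemClass_ne_zero` is gone.
[cite: Kato2004Asterisque, Ex. 13.3 (p. 225), Thm. 12.5 (1) (pp. 221–222), Thm. 13.4 (p. 226), 13.9 (p. 229)] -/
theorem exists_isEulerSystemClass_ne_zero_of_rohrlich (hκ : κ.IsCyclotomic)
    (hES : exists_eulerSystem_expStar_values) (hp : p ≠ 2) (hirr : W.HasIrreducibleModPGaloisRep p)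
    {N : ℕ} [NeZero N] (f : CuspForm (Gamma0 N) 2) (hf : IsNewformOf W f)
    (hR : Set.Finite {χ : Σ m : ℕ, DirichletCharacter ℂ m |
        χ.1 ≠ 0 ∧ χ.1.primeFactors ⊆ {p} ∧ χ.2.IsPrimitive ∧
          ∃ L : ℂ → ℂ, Differentiable ℂ L ∧
            (∀ s : ℂ, 2 < s.re → L s = twistedLSeries f χ.2 s) ∧ L 1 = 0}) :
    ∃ s : I.H, IsEulerSystemClass W p κ γ I s ∧ s ≠ 0 := by
  set ι : (m : ℕ) → (CyclotomicField m ℚ →+* ℂ) :=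
    fun m ↦ Classical.choice (inferInstance : Nonempty (CyclotomicField m ℚ →+* ℂ)) with hι
  obtain ⟨κ', hκ'0, Λ', hfam⟩ := hES W p hirr f hf ι
  obtain ⟨c, d, a, A, d', hA, hc, hd, -, hdd', hRne⟩ := valueGuard_satisfiable f hf.1 hf.coeffField_eq_bot p
  obtain ⟨z, x, hbody⟩ := hfam c d a A hA hc hd
  have hne := two_mul_natAbs_ne_zero_of_guards p hA (NeZero.ne N) hc hd
  obtain ⟨y, hyES, hy⟩ := exists_isEulerSystemClass_of_zetaBody W p hκ hp I f ι κ' Λ' c d a A z x hbody hne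
  exact ⟨y, hyES, zetaBody_lift_ne_zero_of_rohrlich hbody hf hκ'0 hA hc hd hdd' hRne hκ hp hy hR⟩

/-- **`𝐇¹_Γ(T_pW) ≠ 0` in every analytic rank** (odd `p`, `W[p]` irreducible, `f` the newform of `W`, `κ`
cyclotomic, any pin `I`), modulo the construction fact `exists_eulerSystem_expStar_values` and Rohrlich for `f` at
`p` — the «`Z_q ≠ 0`» of Kato Prop. 13.7 / the non-vanishing half of Thm. 12.5 (1).
[cite: Kato2004Asterisque, Thm. 12.5 (1) (pp. 221–222), Prop. 13.7 (p. 227)] -/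
theorem nontrivial_iwasawaH1_of_expStar_values_of_rohrlich (hκ : κ.IsCyclotomic)
    (hES : exists_eulerSystem_expStar_values) (hp : p ≠ 2) (hirr : W.HasIrreducibleModPGaloisRep p)
    {N : ℕ} [NeZero N] (f : CuspForm (Gamma0 N) 2) (hf : IsNewformOf W f)
    (hR : Set.Finite {χ : Σ m : ℕ, DirichletCharacter ℂ m |
        χ.1 ≠ 0 ∧ χ.1.primeFactors ⊆ {p} ∧ χ.2.IsPrimitive ∧
          ∃ L : ℂ → ℂ, Differentiable ℂ L ∧
            (∀ s : ℂ, 2 < s.re → L s = twistedLSeries f χ.2 s) ∧ L 1 = 0}) :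
    Nontrivial I.H := by
  obtain ⟨s, -, hs⟩ := exists_isEulerSystemClass_ne_zero_of_rohrlich W p I hκ hES hp hirr f hf hR
  exact nontrivial_of_ne s 0 hs

/-- **`1 ≤ rank_Λ 𝐇¹_Γ(T_pW)` in every analytic rank** — the statement of the named fact
`Kato2004.one_le_rank_iwasawaH1` ((12.2.2)) at an odd prime `p` with `W[p]` irreducible, for `κ` cyclotomic with a
topological generator `γ` and any pin `I`, modulo the construction fact `exists_eulerSystem_expStar_values`, a
newform `f` of `W` and Rohrlich for `f` at `p` (`𝐇¹` is `Λ`-torsion free: tree theorem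
`IwasawaH1Data.isTorsionFree`, so non-zero means rank `≥ 1`, `one_le_rank_iwasawaH1_of_nontrivial`).
[cite: Kato2004Asterisque, §12.2 (12.2.2) (p. 220), Thm. 12.4 (2) (p. 221), Thm. 12.5 (1) (pp. 221–222)] -/
theorem one_le_rank_iwasawaH1_of_expStar_values_of_rohrlich (hκ : κ.IsCyclotomic) (hγ : κ.IsTopGenerator γ)
    (hES : exists_eulerSystem_expStar_values) (hp : p ≠ 2) (hirr : W.HasIrreducibleModPGaloisRep p)
    {N : ℕ} [NeZero N] (f : CuspForm (Gamma0 N) 2) (hf : IsNewformOf W f)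
    (hR : Set.Finite {χ : Σ m : ℕ, DirichletCharacter ℂ m |
        χ.1 ≠ 0 ∧ χ.1.primeFactors ⊆ {p} ∧ χ.2.IsPrimitive ∧
          ∃ L : ℂ → ℂ, Differentiable ℂ L ∧
            (∀ s : ℂ, 2 < s.re → L s = twistedLSeries f χ.2 s) ∧ L 1 = 0}) :
    1 ≤ Module.rank (IwasawaAlgebra p) I.H := by
  haveI := nontrivial_iwasawaH1_of_expStar_values_of_rohrlich W p I hκ hES hp hirr f hf hR
  exact one_le_rank_iwasawaH1_of_nontrivial hγ I

/-- **The good-reduction case, Rohrlich DISCHARGED in `Literature`**: if every newform of `W` has level prime to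
`p` (e.g. `W` globally minimal with good reduction at `p`), the tree's theorem
`Rohrlich1984_nonvanishing_twists.primePow_of_isNewformOf` supplies `hR`, so a non-zero genuine Euler-system class
exists in every pinned `𝐇¹_Γ(T_pW)` modulo the construction fact and a newform alone (odd `p`, `W[p]` irreducible).
[cite: RohrlichInventiones1984, Theorem (p. 409)] [cite: Kato2004Asterisque, Thm. 12.5 (1) (pp. 221–222)] -/
theorem exists_isEulerSystemClass_ne_zero_of_forall_not_dvd_level (hκ : κ.IsCyclotomic)
    (hES : exists_eulerSystem_expStar_values) (hp : p ≠ 2) (hirr : W.HasIrreducibleModPGaloisRep p)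
    {N : ℕ} [NeZero N] (f : CuspForm (Gamma0 N) 2) (hf : IsNewformOf W f) (hN : ¬ p ∣ N) :
    ∃ s : I.H, IsEulerSystemClass W p κ γ I s ∧ s ≠ 0 :=
  exists_isEulerSystemClass_ne_zero_of_rohrlich W p I hκ hES hp hirr f hf
    (Rohrlich1984_nonvanishing_twists.primePow_of_isNewformOf hf hN)

end Assembly

end Literature.NumberTheory.EllipticCurves.Kato2004

end
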